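import Literature.NumberTheory.Automorphic.GKTensorCohomologySums
import Literature.NumberTheory.Automorphic.HeckeFixedVectorsSimple
import Literature.NumberTheory.Automorphic.HeckeAlgebra
import Mathlib.LinearAlgebra.TensorProduct.Basis
import HarnessLib

/-!
# `H^q(A ⊗ 1)` is a scalar on level-invariant classes of `H^q(𝔤, K_∞; π ⊗ E)`

Topic `NumberTheory/Automorphic`; namespaces `Literature.NumberTheory.Automorphic.GKTensor` and
`Literature.NumberTheory.Automorphic.AutomorphicRepData`. Theorems only (no definition, no named
fact, no `sorry`).

The cohomological half of "Hecke operators act on `H^q(𝔤, K_∞; π ⊗ E)^U` by the Satake scalars"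
(the Eichler–Shimura–Harder glue, Harder 1987, §3; Borel–Wallach I §5.1): for an automorphic
representation `π = W / W'` (Borel–Jacquet model, any regular datum), a finite-dimensional
coefficient `(𝔤, K_∞)`-module `E`, a compact `U' ≤ G(𝔸_f)` and a `(𝔤, K_∞)`-map `A` of `π` which
is the scalar `c` on the `U'`-invariant vectors of `π`,

* `AutomorphicRepData.rTensorCohomologyHom_eq_smul_of_forall_fixed` —
  **`H^q(A ⊗ 1) ξ = c • ξ` for every `U'`-invariant class `ξ`.**

Mechanism (no invariant-representative theorem needed): a class is represented by a cocycle `f`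
whose finitely many coordinates (basis tuples of `𝔤`, a basis of `E`) are fixed by an open
`S ≤ G(𝔸_f)` (smoothness of `π`, Borel–Jacquet 4.6, and `Module.Basis.ext_alternating`); with
the finite sum of translations `T = ∑_{U'/(U' ∩ S)} r(q̃)` one has `H^q(T ⊗ 1) ξ = [U' : U' ∩ S] ξ`,
`H^q(A ⊗ 1) ∘ H^q(T ⊗ 1) = H^q(AT ⊗ 1)` and `AT ⊗ 1 = cT ⊗ 1` on the values of `f` (each
coordinate `y` of a value is `S`-fixed, so `T y` is `U'`-invariant —
`finsum_apply_out_mem_invariants` — and `A (T y) = c T y`); cancel `[U' : U' ∩ S] ≠ 0`.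

Generic tools (`GKTensor`): `rTensorCohomologyHom_comp_apply` (`H^q(S₂S₁ ⊗ 1) = H^q(S₂ ⊗ 1) H^q(S₁ ⊗ 1)`),
`rTensorCohomologyHom_smul_apply` (`H^q(cT ⊗ 1) = c H^q(T ⊗ 1)`),
`rTensorCohomologyHom_toCohomology_congr` (`H^q(S ⊗ 1)[z]` depends only on the values `(S ⊗ 1)(z x)`);
and `AutomorphicRepData.sum_finiteRep_out_apply_eq` (coset sums of `B`-fixed vectors are `U'`-invariant).

## References
* [Harder1987] G. Harder, *Eisenstein cohomology of arithmetic groups. The case GL₂*, §3.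
* [BorelWallach2000] A. Borel, N. Wallach, 2nd ed., I §1.2, I §5.1.
* [BorelJacquetCorvallis1979] A. Borel, H. Jacquet, Corvallis 1979, §4.6.
* [Bump1997] D. Bump, *Automorphic forms and representations*, §4.2 (the averaging idempotents).
-/

noncomputable section

namespace Literature.NumberTheory.Automorphic

open Module Literature.Algebra.Lie
open scoped TensorProduct

attribute [local instance 100] LieRing.ofAssociativeRing

section Generic

variable {A : Type*} [NormedCommRing A] [NormedAlgebra ℝ A] [NormedAlgebra ℚ A] [CompleteSpace A]
  [StarRing A] [StarModule ℝ A] {N : Type*} [Fintype N] [DecidableEq N] (G : RealMatrixGroup A N)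
  {V : Type*} [AddCommGroup V] [Module ℂ V]
  (ρK : Representation ℂ G.maximalCompact V) (ρ𝔤 : G.lie →ₗ⁅ℝ⁆ Module.End ℂ V)
  {W : Type*} [AddCommGroup W] [Module ℂ W]
  (σK : Representation ℂ G.maximalCompact W) (σ𝔤 : G.lie →ₗ⁅ℝ⁆ Module.End ℂ W)
  (hV : ∀ (k : G.maximalCompact) (X : G.lie),
    ρK k ∘ₗ ρ𝔤 X ∘ₗ ρK k⁻¹ = ρ𝔤 (G.Ad (Subgroup.inclusion G.maximalCompact_le_carrier k) X))
  (hW : ∀ (k : G.maximalCompact) (X : G.lie),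
    σK k ∘ₗ σ𝔤 X ∘ₗ σK k⁻¹ = σ𝔤 (G.Ad (Subgroup.inclusion G.maximalCompact_le_carrier k) X))

namespace GKTensor

/-- **Composition**: `H^q((A ∘ T) ⊗ 1) = H^q(A ⊗ 1) ∘ H^q(T ⊗ 1)`. [cite: BorelWallach2000, I §1.2] -/
theorem rTensorCohomologyHom_comp_apply (S₂ S₁ : V →ₗ[ℂ] V)
    (h₂𝔤 : ∀ X : G.lie, S₂ ∘ₗ ρ𝔤 X = ρ𝔤 X ∘ₗ S₂) (h₂K : ∀ k : G.maximalCompact, S₂ ∘ₗ ρK k = ρK k ∘ₗ S₂)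
    (h₁𝔤 : ∀ X : G.lie, S₁ ∘ₗ ρ𝔤 X = ρ𝔤 X ∘ₗ S₁) (h₁K : ∀ k : G.maximalCompact, S₁ ∘ₗ ρK k = ρK k ∘ₗ S₁)
    (h𝔤 : ∀ X : G.lie, (S₂ ∘ₗ S₁) ∘ₗ ρ𝔤 X = ρ𝔤 X ∘ₗ (S₂ ∘ₗ S₁))
    (hK : ∀ k : G.maximalCompact, (S₂ ∘ₗ S₁) ∘ₗ ρK k = ρK k ∘ₗ (S₂ ∘ₗ S₁)) (q : ℕ)
    (x : GKTensor.cohomology G ρK ρ𝔤 σK σ𝔤 hV hW q) :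
    rTensorCohomologyHom G ρK ρ𝔤 σK σ𝔤 hV hW (S₂ ∘ₗ S₁) h𝔤 hK q x =
      rTensorCohomologyHom G ρK ρ𝔤 σK σ𝔤 hV hW S₂ h₂𝔤 h₂K q
        (rTensorCohomologyHom G ρK ρ𝔤 σK σ𝔤 hV hW S₁ h₁𝔤 h₁K q x) := by
  unfold rTensorCohomologyHom
  rw [LinearMap.congr_fun (gkCohomologyHom_congr G _ _ _ _ _ _ (LinearMap.rTensor_comp W S₂ S₁) _ _
      (comp_comm𝔤 G _ _ _ _ (rTensor_comm_lie G ρ𝔤 σ𝔤 S₁ h₁𝔤) _ (rTensor_comm_lie G ρ𝔤 σ𝔤 S₂ h₂𝔤))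
      (comp_commK G _ _ _ _ (rTensor_comm_tprod G ρK σK S₁ h₁K) _ (rTensor_comm_tprod G ρK σK S₂ h₂K))
      q) x]
  exact gkCohomologyHom_comp G _ _ _ _ _ _ _ _ _ _ _ _ _ _ _ _ _ q x

/-- **Scalars**: `H^q((c • T) ⊗ 1) = c • H^q(T ⊗ 1)`. [cite: BorelWallach2000, I §1.2] -/
theorem rTensorCohomologyHom_smul_apply (c : ℂ) (T : V →ₗ[ℂ] V)
    (hT𝔤 : ∀ X : G.lie, T ∘ₗ ρ𝔤 X = ρ𝔤 X ∘ₗ T) (hTK : ∀ k : G.maximalCompact, T ∘ₗ ρK k = ρK k ∘ₗ T)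
    (hc𝔤 : ∀ X : G.lie, (c • T) ∘ₗ ρ𝔤 X = ρ𝔤 X ∘ₗ (c • T))
    (hcK : ∀ k : G.maximalCompact, (c • T) ∘ₗ ρK k = ρK k ∘ₗ (c • T)) (q : ℕ)
    (x : GKTensor.cohomology G ρK ρ𝔤 σK σ𝔤 hV hW q) :
    rTensorCohomologyHom G ρK ρ𝔤 σK σ𝔤 hV hW (c • T) hc𝔤 hcK q x =
      c • rTensorCohomologyHom G ρK ρ𝔤 σK σ𝔤 hV hW T hT𝔤 hTK q x := by
  unfold rTensorCohomologyHom
  have hsm : ((c • T).rTensor W) = c • T.rTensor W := LinearMap.rTensor_smul W c T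
  rw [LinearMap.congr_fun (gkCohomologyHom_congr G _ _ _ _ _ _ hsm _ _
      (fun X => by rw [← hsm]; exact rTensor_comm_lie G ρ𝔤 σ𝔤 _ hc𝔤 X)
      (fun k => by rw [← hsm]; exact rTensor_comm_tprod G ρK σK _ hcK k) q) x]
  exact gkCohomologyHom_smul_left G _ _ _ _ _ _ c (T.rTensor W)
    (rTensor_comm_lie G ρ𝔤 σ𝔤 T hT𝔤) (rTensor_comm_tprod G ρK σK T hTK) _ _ q x

/-- **`H^q(S ⊗ 1)[z]` only depends on the values `(S ⊗ 1)(z(x))`**: two maps agreeing on the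
values of a cocycle give the same class. [folklore] -/
theorem rTensorCohomologyHom_toCohomology_congr (S₁ S₂ : V →ₗ[ℂ] V)
    (h₁𝔤 : ∀ X : G.lie, S₁ ∘ₗ ρ𝔤 X = ρ𝔤 X ∘ₗ S₁) (h₁K : ∀ k : G.maximalCompact, S₁ ∘ₗ ρK k = ρK k ∘ₗ S₁)
    (h₂𝔤 : ∀ X : G.lie, S₂ ∘ₗ ρ𝔤 X = ρ𝔤 X ∘ₗ S₂) (h₂K : ∀ k : G.maximalCompact, S₂ ∘ₗ ρK k = ρK k ∘ₗ S₂)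
    (q : ℕ)
    (z : (gkComplex G (ρK.tprod σK) (GKTensor.lie G ρ𝔤 σ𝔤)
      (GKTensor.ad_compat G ρK ρ𝔤 σK σ𝔤 hV hW)).cocycles q)
    (h : ∀ x : Fin q → G.lie,
      S₁.rTensor W ((z : ChevalleyEilenberg.Cochain ℝ G.lie
        (GKCarrier G (GKTensor.lie G ρ𝔤 σ𝔤)) q) x) =
      S₂.rTensor W ((z : ChevalleyEilenberg.Cochain ℝ G.lie
        (GKCarrier G (GKTensor.lie G ρ𝔤 σ𝔤)) q) x)) :
    rTensorCohomologyHom G ρK ρ𝔤 σK σ𝔤 hV hW S₁ h₁𝔤 h₁K q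
        ((gkComplex G (ρK.tprod σK) (GKTensor.lie G ρ𝔤 σ𝔤)
          (GKTensor.ad_compat G ρK ρ𝔤 σK σ𝔤 hV hW)).toCohomology q z) =
      rTensorCohomologyHom G ρK ρ𝔤 σK σ𝔤 hV hW S₂ h₂𝔤 h₂K q
        ((gkComplex G (ρK.tprod σK) (GKTensor.lie G ρ𝔤 σ𝔤)
          (GKTensor.ad_compat G ρK ρ𝔤 σK σ𝔤 hV hW)).toCohomology q z) := by
  unfold rTensorCohomologyHom
  rw [gkCohomologyHom_apply, gkCohomologyHom_apply,
    ChevalleyEilenberg.Subcomplex.IsCochainMapTo.cohomologyMap_toCohomology,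
    ChevalleyEilenberg.Subcomplex.IsCochainMapTo.cohomologyMap_toCohomology]
  congr 1
  refine Subtype.ext ?_
  rw [ChevalleyEilenberg.Subcomplex.IsCochainMapTo.coe_cocyclesMap,
    ChevalleyEilenberg.Subcomplex.IsCochainMapTo.coe_cocyclesMap]
  ext x
  exact h x

end GKTensor

end Generic

namespace AutomorphicRepData

open MulAction

variable {K : Type} [Field K] [NumberField K]
  {A : Type*} [NormedCommRing A] [NormedAlgebra ℝ A] [NormedAlgebra ℚ A] [CompleteSpace A]
  [StarRing A] {N : Type*} [Fintype N] [DecidableEq N]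
  {𝒢 : AdelicGroupData K} {𝒟 : AutomorphyDatum 𝒢 A N} (π : AutomorphicRepData 𝒟)
  [StarModule ℝ A] [ContinuousStar A] [FiniteDimensional ℝ A]
  {E : Type*} [AddCommGroup E] [Module ℂ E] [FiniteDimensional ℂ E]
  (σK : Representation ℂ 𝒟.arch.maximalCompact E) (σ𝔤 : 𝒟.arch.lie →ₗ⁅ℝ⁆ Module.End ℂ E)
  (hE : ∀ (k : 𝒟.arch.maximalCompact) (X : 𝒟.arch.lie),
    σK k ∘ₗ σ𝔤 X ∘ₗ σK k⁻¹ =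
      σ𝔤 (𝒟.arch.Ad (Subgroup.inclusion 𝒟.arch.maximalCompact_le_carrier k) X))

omit [StarModule ℝ A] [ContinuousStar A] [FiniteDimensional ℝ A] in
/-- The coset sum `∑_{U'/B} r(q̃) y` of a `B`-fixed vector is `U'`-invariant. [folklore] -/
theorem sum_finiteRep_out_apply_eq (U' : Subgroup 𝒟.finiteAdelic) (B : Subgroup U') [B.FiniteIndex]
    [Fintype (U' ⧸ B)] {y : π.Quot} (hy : ∀ b : U', b ∈ B → π.finiteRep b y = y) (u : U') :
    π.finiteRep u (∑ qq : U' ⧸ B, π.finiteRep (qq.out : U') y) =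
      ∑ qq : U' ⧸ B, π.finiteRep (qq.out : U') y := by
  classical
  have hfix : y ∈ Representation.fixedPoints (π.finiteRep.comp U'.subtype) B := by
    rw [Representation.mem_fixedPoints]
    intro b hb
    exact hy b hb
  have h := finsum_apply_out_mem_invariants (π.finiteRep.comp U'.subtype) B hfix
  rw [finsum_eq_sum_of_fintype, Representation.mem_invariants] at h
  exact h u

set_option maxHeartbeats 400000 in
/-- **`H^q(A ⊗ 1)` is the scalar `c` on `U'`-invariant classes when `A` is `c` on the
`U'`-invariant vectors of `π = W / W'`** (`U' ≤ G(𝔸_f)` compact; `A` a `(𝔤, K_∞)`-map; `E` a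
finite-dimensional coefficient module).  Mechanism: a class is represented by a cocycle `f` whose
finitely many coordinates (basis tuples of `𝔤`, a basis of `E`) are fixed by an open `S ≤ G(𝔸_f)`
(smoothness of `π`, Borel–Jacquet 4.6); with the finite sum of translations
`T = ∑_{U'/(U' ∩ S)} r(q̃)`: `H^q(T ⊗ 1) ξ = [U' : U' ∩ S] ξ` for `U'`-invariant `ξ`,
`H^q(A ⊗ 1) ∘ H^q(T ⊗ 1) = H^q(AT ⊗ 1)` and `AT ⊗ 1 = cT ⊗ 1` on the values of `f` (each
coordinate `y` of a value is `S`-fixed, so `T y` is `U'`-invariant and `A (T y) = c T y`).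
[cite: BorelWallach2000, I §5.1] [cite: Harder1987, §3] -/
theorem rTensorCohomologyHom_eq_smul_of_forall_fixed (h𝒟 : 𝒟.IsRegular)
    {ρ𝔤 : 𝒟.arch.lie →ₗ⁅ℝ⁆ Module.End ℂ π.Quot} (hρ : π.HasLieAction ρ𝔤) (q : ℕ)
    (U' : Subgroup 𝒟.finiteAdelic) (hU'c : IsCompact (U' : Set 𝒟.finiteAdelic))
    (T₀ : π.Quot →ₗ[ℂ] π.Quot)
    (hA𝔤 : ∀ X : 𝒟.arch.lie, T₀ ∘ₗ ρ𝔤 X = ρ𝔤 X ∘ₗ T₀)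
    (hAK : ∀ k : 𝒟.arch.maximalCompact, T₀ ∘ₗ π.kRep k = π.kRep k ∘ₗ T₀) (c : ℂ)
    (hAc : ∀ x : π.Quot, (∀ u ∈ U', π.finiteRep u x = x) → T₀ x = c • x)
    {ξ : π.gkCohomologyWith σK σ𝔤 hE h𝒟 hρ q}
    (hξ : ∀ u ∈ U', π.cohomologyRepWith σK σ𝔤 hE h𝒟 hρ q u ξ = ξ) :
    GKTensor.rTensorCohomologyHom 𝒟.arch π.kRep ρ𝔤 σK σ𝔤
        (π.isGKModule_of_hasLieAction_holds h𝒟 hρ).ad_compat hE T₀ hA𝔤 hAK q ξ = c • ξ := by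
  classical
  have hV := (π.isGKModule_of_hasLieAction_holds h𝒟 hρ).ad_compat
  -- a cocycle representative
  obtain ⟨z, hz⟩ := (gkComplex 𝒟.arch (π.kRep.tprod σK) (GKTensor.lie 𝒟.arch ρ𝔤 σ𝔤)
    (GKTensor.ad_compat 𝒟.arch π.kRep ρ𝔤 σK σ𝔤 hV hE)).toCohomology_surjective q ξ
  -- bases of `𝔤` (real) and of `E` (complex); coordinates on `π ⊗ E`
  haveI : Module.Finite ℝ 𝒟.arch.lie :=
    Module.Finite.of_injective (𝒟.arch.lie.incl : 𝒟.arch.lie →ₗ⁅ℝ⁆ Matrix N N A).toLinearMap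
      Subtype.val_injective
  let e := Module.finBasis ℝ 𝒟.arch.lie
  let 𝒞 := Module.finBasis ℂ E
  let Φ := TensorProduct.equivFinsuppOfBasisRight (M := π.Quot) 𝒞
  let zv : (Fin q → 𝒟.arch.lie) → π.Quot ⊗[ℂ] E := fun x =>
    (z : ChevalleyEilenberg.Cochain ℝ 𝒟.arch.lie (GKCarrier 𝒟.arch (GKTensor.lie 𝒟.arch ρ𝔤 σ𝔤)) q) x
  -- the open subgroup `S` fixing all coordinates of the values of `z` on basis tuples
  let S : Subgroup 𝒟.finiteAdelic :=
    ⨅ v : Fin q → Fin (Module.finrank ℝ 𝒟.arch.lie), ⨅ i : Fin (Module.finrank ℂ E),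
      π.finiteRep.stabilizerSubgroup (Φ (zv fun l => e (v l)) i)
  have hSo : IsOpen (S : Set 𝒟.finiteAdelic) := by
    change IsOpen ((⨅ v : Fin q → Fin (Module.finrank ℝ 𝒟.arch.lie), ⨅ i : Fin (Module.finrank ℂ E),
      π.finiteRep.stabilizerSubgroup (Φ (zv fun l => e (v l)) i) : Subgroup 𝒟.finiteAdelic) :
        Set 𝒟.finiteAdelic)
    rw [Subgroup.coe_iInf]
    refine isOpen_iInter_of_finite fun v => ?_
    rw [Subgroup.coe_iInf]
    exact isOpen_iInter_of_finite fun i => π.isSmooth_finiteRep_holds h𝒟 _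
  -- every coordinate of every value of `z` is fixed by `S`
  have hcoord : ∀ (x : Fin q → 𝒟.arch.lie) (i : Fin (Module.finrank ℂ E)),
      ∀ s ∈ S, π.finiteRep s (Φ (zv x) i) = Φ (zv x) i := by
    intro x i
    let P : Submodule ℂ π.Quot := π.finiteRep.fixedPoints S
    let Li : π.Quot ⊗[ℂ] E →ₗ[ℂ] π.Quot ⧸ P := P.mkQ ∘ₗ Finsupp.lapply i ∘ₗ Φ.toLinearMap
    have hzero : (Li.restrictScalars ℝ).compAlternatingMap
        (show 𝒟.arch.lie [⋀^Fin q]→ₗ[ℝ] (π.Quot ⊗[ℂ] E) from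
          (z : ChevalleyEilenberg.Cochain ℝ 𝒟.arch.lie
            (GKCarrier 𝒟.arch (GKTensor.lie 𝒟.arch ρ𝔤 σ𝔤)) q)) = 0 := by
      refine Module.Basis.ext_alternating e fun v _ => ?_
      rw [LinearMap.compAlternatingMap_apply, AlternatingMap.zero_apply, LinearMap.restrictScalars_apply]
      change P.mkQ (Φ (zv fun l => e (v l)) i) = 0
      rw [Submodule.mkQ_apply, Submodule.Quotient.mk_eq_zero, Representation.mem_fixedPoints]
      intro s hs
      have hs' := (Subgroup.mem_iInf.1 ((Subgroup.mem_iInf.1 hs) v)) i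
      exact hs'
    have hx := congrArg (fun g => g x) hzero
    simp only [LinearMap.compAlternatingMap_apply, AlternatingMap.zero_apply,
      LinearMap.restrictScalars_apply] at hx
    change P.mkQ (Φ (zv x) i) = 0 at hx
    rw [Submodule.mkQ_apply, Submodule.Quotient.mk_eq_zero, Representation.mem_fixedPoints] at hx
    exact hx
  -- `B = U' ∩ S` has finite index in the compact `U'`
  haveI hfi : (S.subgroupOf U').FiniteIndex := ⟨relIndex_ne_zero_of_isOpen_of_isCompact hSo hU'c⟩
  haveI : Fintype (U' ⧸ S.subgroupOf U') := Fintype.ofFinite _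
  -- the finite sum of translations `T`
  let T : π.Quot →ₗ[ℂ] π.Quot := ∑ qq : U' ⧸ S.subgroupOf U', π.finiteRep (qq.out : U')
  have hT𝔤 : ∀ X : 𝒟.arch.lie, T ∘ₗ ρ𝔤 X = ρ𝔤 X ∘ₗ T :=
    sum_comm𝔤 𝒟.arch ρ𝔤 ρ𝔤 Finset.univ _ fun qq X => π.finiteRep_comm_of_hasLieAction hρ _ X
  have hTK : ∀ k : 𝒟.arch.maximalCompact, T ∘ₗ π.kRep k = π.kRep k ∘ₗ T :=
    sum_commK 𝒟.arch π.kRep π.kRep Finset.univ _ fun qq k => π.finiteRep_comm_kRep _ k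
  -- (F3) `H^q(T ⊗ 1) ξ = [U':B] ξ`
  set m : ℕ := Fintype.card (U' ⧸ S.subgroupOf U') with hm
  have hF3 : GKTensor.rTensorCohomologyHom 𝒟.arch π.kRep ρ𝔤 σK σ𝔤 hV hE T hT𝔤 hTK q ξ =
      (m : ℂ) • ξ := by
    rw [← GKTensor.sum_rTensorCohomologyHom 𝒟.arch π.kRep ρ𝔤 σK σ𝔤 hV hE Finset.univ
      (fun qq : U' ⧸ S.subgroupOf U' => π.finiteRep (qq.out : U'))
      (fun qq X => π.finiteRep_comm_of_hasLieAction hρ _ X) (fun qq k => π.finiteRep_comm_kRep _ k) q]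
    have hterm : ∀ qq : U' ⧸ S.subgroupOf U',
        GKTensor.rTensorCohomologyHom 𝒟.arch π.kRep ρ𝔤 σK σ𝔤 hV hE (π.finiteRep (qq.out : U'))
          (fun X => π.finiteRep_comm_of_hasLieAction hρ _ X) (fun k => π.finiteRep_comm_kRep _ k) q
          ξ = ξ := by
      intro qq
      have h := hξ (qq.out : U') (qq.out : U').2
      unfold AutomorphicRepData.cohomologyRepWith at h
      exact (LinearMap.congr_fun (GKTensor.cohomologyRep_apply_eq 𝒟.arch π.kRep ρ𝔤 σK σ𝔤 hV hE
        π.finiteRep (fun g X => π.finiteRep_comm_of_hasLieAction hρ g X)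
        (fun g k => π.finiteRep_comm_kRep g k) q (qq.out : U')) _).symm.trans h
    simp only [hterm, Finset.sum_const, Finset.card_univ]
    rw [← Nat.cast_smul_eq_nsmul ℂ]
  -- (F2) `(T₀ T ⊗ 1)` and `(c T ⊗ 1)` agree on the values of `z`
  have hTy : ∀ (x : Fin q → 𝒟.arch.lie) (i : Fin (Module.finrank ℂ E)),
      ∀ u ∈ U', π.finiteRep u (T (Φ (zv x) i)) = T (Φ (zv x) i) := by
    intro x i u hu
    have h := π.sum_finiteRep_out_apply_eq U' (S.subgroupOf U')
      (y := Φ (zv x) i) (fun b hb => hcoord x i b (Subgroup.mem_subgroupOf.1 hb)) ⟨u, hu⟩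
    simpa only [T, LinearMap.sum_apply] using h
  have hF2 : ∀ x : Fin q → 𝒟.arch.lie,
      (T₀ ∘ₗ T).rTensor E (zv x) = (c • T).rTensor E (zv x) := by
    intro x
    have hdec : zv x = Φ.symm (Φ (zv x)) := (Φ.symm_apply_apply _).symm
    rw [hdec, TensorProduct.equivFinsuppOfBasisRight_symm_apply, Finsupp.sum, map_sum, map_sum]
    refine Finset.sum_congr rfl fun i _ => ?_
    rw [LinearMap.rTensor_tmul, LinearMap.rTensor_tmul, LinearMap.comp_apply,
      LinearMap.smul_apply, hAc _ (hTy x i)]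
  have hcomp := GKTensor.rTensorCohomologyHom_comp_apply 𝒟.arch π.kRep ρ𝔤 σK σ𝔤 hV hE T₀ T
    hA𝔤 hAK hT𝔤 hTK (comp_comm𝔤 𝒟.arch _ _ _ T hT𝔤 T₀ hA𝔤) (comp_commK 𝒟.arch _ _ _ T hTK T₀ hAK) q ξ
  have hc𝔤 : ∀ X : 𝒟.arch.lie, (c • T) ∘ₗ ρ𝔤 X = ρ𝔤 X ∘ₗ (c • T) := fun X => by
    rw [LinearMap.smul_comp, LinearMap.comp_smul, hT𝔤]
  have hcK : ∀ k : 𝒟.arch.maximalCompact, (c • T) ∘ₗ π.kRep k = π.kRep k ∘ₗ (c • T) := fun k => by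
    rw [LinearMap.smul_comp, LinearMap.comp_smul, hTK]
  have hcongr : GKTensor.rTensorCohomologyHom 𝒟.arch π.kRep ρ𝔤 σK σ𝔤 hV hE (T₀ ∘ₗ T)
      (comp_comm𝔤 𝒟.arch _ _ _ T hT𝔤 T₀ hA𝔤) (comp_commK 𝒟.arch _ _ _ T hTK T₀ hAK) q ξ =
      GKTensor.rTensorCohomologyHom 𝒟.arch π.kRep ρ𝔤 σK σ𝔤 hV hE (c • T) hc𝔤 hcK q ξ := by
    rw [← hz]
    exact GKTensor.rTensorCohomologyHom_toCohomology_congr 𝒟.arch π.kRep ρ𝔤 σK σ𝔤 hV hE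
      (T₀ ∘ₗ T) (c • T) (comp_comm𝔤 𝒟.arch _ _ _ T hT𝔤 T₀ hA𝔤) (comp_commK 𝒟.arch _ _ _ T hTK T₀ hAK)
      hc𝔤 hcK q z hF2
  have hsmul := GKTensor.rTensorCohomologyHom_smul_apply 𝒟.arch π.kRep ρ𝔤 σK σ𝔤 hV hE c T
    hT𝔤 hTK hc𝔤 hcK q ξ
  have hm0 : (m : ℂ) ≠ 0 := Nat.cast_ne_zero.2 Fintype.card_ne_zero
  have e2 : GKTensor.rTensorCohomologyHom 𝒟.arch π.kRep ρ𝔤 σK σ𝔤 hV hE T₀ hA𝔤 hAK q ((m : ℂ) • ξ) =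
      (m : ℂ) • GKTensor.rTensorCohomologyHom 𝒟.arch π.kRep ρ𝔤 σK σ𝔤 hV hE T₀ hA𝔤 hAK q ξ :=
    map_smul _ _ _
  have key : (m : ℂ) • GKTensor.rTensorCohomologyHom 𝒟.arch π.kRep ρ𝔤 σK σ𝔤 hV hE T₀ hA𝔤 hAK q ξ =
      (m : ℂ) • (c • ξ) := by
    rw [← e2, ← hF3, ← hcomp, hcongr, hsmul, hF3, smul_comm]
  exact smul_right_injective _ hm0 key

end AutomorphicRepData

end Literature.NumberTheory.Automorphic

end
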